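/-
Copyright: the b2b-balaban T⁴-continuum CRUX team, row NE7b OWNER lineage `t4-ne7b-p1` (gen 109). Project licence.
-/
import Mathlib.Analysis.Calculus.ParametricIntegral
import Mathlib.Analysis.Calculus.Gradient.Basic
import Mathlib.Analysis.SpecialFunctions.Log.Deriv
import Mathlib.Analysis.SpecialFunctions.ExpDeriv

/-!
# THE MARGINAL EXPONENT IS DIFFERENTIABLE, WITH GRADIENT THE TILTED MEAN OF THE BASE GRADIENT:
# `d/dx (−log ∫ e^{−V(x,y)} dμ(y)) = ⟨∂ₓV(x,·)⟩_{ν_x}` by dominated differentiation (row NE7b, node U5c; residual (R2′) family (2);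
# the differentiability half of `…LogConcaveMarginal` §5's round trip, for fibre windows that do not move with the base point)

Cell `pub-balaban`, sub-cell `t4`, spine estimate NE7b (`T4WeightBudget.RelWeightBound`; the cell's OWN estimate — NOT PRINTED in
[Bałaban 1983–89], NOT PROVED).  Crux-route work under `Spine/NE7b/` by the row's OWNER; NOTHING of Bałaban's is named or asserted;
no `T4Continuum/Support` leaf typed; no `def`; zero `sorry`.  Mathlib only (`hasFDerivAt_integral_of_dominated_of_fderiv_le` BY NAME).

WHY.  `…LogConcaveMarginal` shows that the marginal exponent `V⁺(x) = −log ∫_{K_x} e^{−V(x,y)} dy` inherits the convexity modulus of `V` in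
the base direction (secant currency, `StrongConvexOn`), and its §5 turns `StrongConvexOn` back into the sockets' first-order letter AT
EVERY POINT WHERE `V⁺` IS DIFFERENTIABLE.  For a PRODUCT window `K = B ×ˢ K_y` (base window × fluctuation window — the fibre does not move
with `x`) that differentiability is dominated differentiation under the integral sign; this file proves it for a general fibre measure
`μ` (take `μ = volume.restrict K_y`), with the derivative in closed form: the `ν_x`-tilted mean of the base derivative of `V`,
`ν_x = e^{−V(x,·)}μ ∕ ∫ e^{−V(x,·)} dμ`.

WHAT IS PROVED ([folklore]):
* §1 **`hasFDerivAt_fibreIntegral`** — base `H` a real normed space, fibre `(α, μ)` any measure space, `V : H × α → ℝ`, a neighbourhood `U` of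
  `x₀` on which: the sections `V(x,·)` are a.e.-strongly measurable, `V(·,y)` has Fréchet derivative `Vx(x,y)` for every `y`, and
  `e^{−V(x,y)}‖Vx(x,y)‖ ≤ bound(y)` with `bound` `μ`-integrable; `e^{−V(x₀,·)}` integrable and `Vx(x₀,·)` a.e.-strongly measurable ⟹
  `x ↦ ∫ e^{−V(x,y)} dμ(y)` has derivative `−∫ e^{−V(x₀,y)}·Vx(x₀,y) dμ(y)` at `x₀`.
* §2 **`hasFDerivAt_neg_log_fibreIntegral`** — if moreover `Z = ∫ e^{−V(x₀,·)} dμ > 0`: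
  `V⁺ = −log ∫ e^{−V(·,y)} dμ` has derivative `Z⁻¹ • ∫ e^{−V(x₀,y)}·Vx(x₀,y) dμ(y)` at `x₀` (THE TILTED MEAN OF THE BASE DERIVATIVE);
  **`hasGradientAt_neg_log_fibreIntegral`** — the same in the gradient currency of the sockets (`H` a real Hilbert space).
* §3 **`hasFDerivAt_neg_log_fibreIntegral_of_bounded`** — THE BOUNDED-WINDOW SUPPLIER: `μ` finite, `vmin ≤ V` and `‖Vx‖ ≤ M` on `U × α`
  discharge the integrability and domination letters (`bound ≡ e^{−vmin}M`).
* §4 **`fibre_prod_eq`**, **`eventuallyEq_fibreIntegral_prod`** — for a PRODUCT window `K = B ×ˢ K_y` and `x ∈ B` the fibre of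
  `…LogConcaveMarginal` is `K_y`, so near an interior base point the windowed marginal `x ↦ ∫_{K_x} e^{−V(x,·)}` coincides with
  `x ↦ ∫_{K_y} e^{−V(x,·)}` (junction of the two files' conventions; derivatives transfer by `HasFDerivAt.congr_of_eventuallyEq`).

NOT HERE (honest): windows whose fibre MOVES with the base point (then boundary terms enter — not the product case); second
derivatives of `V⁺` (the Brascamp–Lieb covariance formula); which of print's windows are products in which chart ((A3)); anything of
Bałaban's.  BY-NAME EFFECT ON THE WALL: NONE.  NE7b NOT PRINTED ∕ NOT PROVED; spine PROVED 0∕9; rung (B)+1 on a FINITE torus — NOT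
infinite volume, NOT the mass gap, NOT Clay.
HONEST DEPENDENCY: continuum YM on T⁴ ⇐ BetaPertH ∧ nine spine estimates (0/9 proved); BetaPertH ⇐ (D1) ∧ (D4) ∧ CAP+tail.
-/

set_option autoImplicit false

noncomputable section

open MeasureTheory Real Set Filter
open scoped RealInnerProductSpace Topology

namespace Summit.QuantumFields.BalabanUV.T4Continuum.NE7b.LogConcaveMarginalDeriv

/-! ## §1 Dominated differentiation of the fibre integral -/

section FibreIntegral

variable {H : Type*} [NormedAddCommGroup H] [NormedSpace ℝ H] {α : Type*} [MeasurableSpace α] {μ : Measure α}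

/-- **DIFFERENTIATION UNDER THE FIBRE INTEGRAL.**  Base `H` (real normed space), fibre measure `μ` on `α`, exponent `V : H × α → ℝ` with
base derivative `Vx`; on a neighbourhood `U` of `x₀`: measurable sections, `HasFDerivAt (V(·,y)) (Vx(x,y)) x`, and the domination
`e^{−V(x,y)}‖Vx(x,y)‖ ≤ bound y` with `bound` integrable; at `x₀`: `e^{−V(x₀,·)}` integrable, `Vx(x₀,·)` a.e.-strongly measurable.  Then
`x ↦ ∫ e^{−V(x,y)} dμ(y)` has Fréchet derivative `−∫ e^{−V(x₀,y)} • Vx(x₀,y) dμ(y)` at `x₀`. [folklore] -/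
theorem hasFDerivAt_fibreIntegral {V : H × α → ℝ} {Vx : H × α → (H →L[ℝ] ℝ)} {x₀ : H} {U : Set H} (hU : U ∈ 𝓝 x₀)
    (hVm : ∀ x ∈ U, AEStronglyMeasurable (fun y => V (x, y)) μ)
    (hI : Integrable (fun y => exp (-V (x₀, y))) μ)
    (hVxm : AEStronglyMeasurable (fun y => Vx (x₀, y)) μ)
    (hVd : ∀ x ∈ U, ∀ y, HasFDerivAt (fun x' => V (x', y)) (Vx (x, y)) x)
    {bound : α → ℝ} (hbound : Integrable bound μ) (hb : ∀ x ∈ U, ∀ y, exp (-V (x, y)) * ‖Vx (x, y)‖ ≤ bound y) :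
    HasFDerivAt (fun x => ∫ y, exp (-V (x, y)) ∂μ) (-∫ y, exp (-V (x₀, y)) • Vx (x₀, y) ∂μ) x₀ := by
  have key := hasFDerivAt_integral_of_dominated_of_fderiv_le (μ := μ) (x₀ := x₀)
    (F := fun x y => exp (-V (x, y))) (F' := fun x y => exp (-V (x, y)) • -Vx (x, y)) (bound := bound) hU
    (by
      filter_upwards [hU] with x hx
      exact continuous_exp.comp_aestronglyMeasurable (hVm x hx).neg)
    hI (by exact (continuous_exp.comp_aestronglyMeasurable (hVm x₀ (mem_of_mem_nhds hU)).neg).smul hVxm.neg)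
    (Eventually.of_forall fun y x hx => by
      rw [norm_smul, norm_neg, Real.norm_eq_abs, abs_of_pos (exp_pos _)]
      exact hb x hx y)
    hbound
    (Eventually.of_forall fun y x hx => ((hVd x hx y).neg).exp)
  have e : ∫ y, exp (-V (x₀, y)) • -Vx (x₀, y) ∂μ = -∫ y, exp (-V (x₀, y)) • Vx (x₀, y) ∂μ := by
    rw [← integral_neg]
    exact integral_congr_ae (Eventually.of_forall fun y => smul_neg _ _)
  rw [e] at key
  exact key

/-! ## §2 The marginal exponent `−log ∫ e^{−V(·,y)} dμ`: derivative = tilted mean of the base derivative -/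

/-- **THE MARGINAL EXPONENT IS DIFFERENTIABLE**: under the hypotheses of `hasFDerivAt_fibreIntegral` and `0 < Z = ∫ e^{−V(x₀,·)} dμ`,
`V⁺ = x ↦ −log ∫ e^{−V(x,y)} dμ(y)` has Fréchet derivative `Z⁻¹ • ∫ e^{−V(x₀,y)} • Vx(x₀,y) dμ(y)` at `x₀` — the mean of the base
derivative under the tilted fibre law `ν_{x₀} = e^{−V(x₀,·)}μ∕Z`. [folklore] -/
theorem hasFDerivAt_neg_log_fibreIntegral {V : H × α → ℝ} {Vx : H × α → (H →L[ℝ] ℝ)} {x₀ : H} {U : Set H} (hU : U ∈ 𝓝 x₀)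
    (hVm : ∀ x ∈ U, AEStronglyMeasurable (fun y => V (x, y)) μ)
    (hI : Integrable (fun y => exp (-V (x₀, y))) μ)
    (hVxm : AEStronglyMeasurable (fun y => Vx (x₀, y)) μ)
    (hVd : ∀ x ∈ U, ∀ y, HasFDerivAt (fun x' => V (x', y)) (Vx (x, y)) x)
    {bound : α → ℝ} (hbound : Integrable bound μ) (hb : ∀ x ∈ U, ∀ y, exp (-V (x, y)) * ‖Vx (x, y)‖ ≤ bound y)
    (hZ : 0 < ∫ y, exp (-V (x₀, y)) ∂μ) :
    HasFDerivAt (fun x => -log (∫ y, exp (-V (x, y)) ∂μ))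
      ((∫ y, exp (-V (x₀, y)) ∂μ)⁻¹ • ∫ y, exp (-V (x₀, y)) • Vx (x₀, y) ∂μ) x₀ := by
  have h := ((hasFDerivAt_fibreIntegral hU hVm hI hVxm hVd hbound hb).log hZ.ne').neg
  rw [smul_neg, neg_neg] at h
  exact h

/-- **GRADIENT CURRENCY** (base a real Hilbert space, as the sockets' `EuclideanSpace ℝ (Fin m)`): `V⁺` has gradient
`(toDual)⁻¹(Z⁻¹ • ∫ e^{−V(x₀,y)} • Vx(x₀,y) dμ)` at `x₀`; in particular `V⁺` is differentiable at `x₀` and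
`…LogConcaveMarginal.firstOrder_of_strongConvexOn_hasGradientAt` applies there. [folklore] -/
theorem hasGradientAt_neg_log_fibreIntegral {H : Type*} [NormedAddCommGroup H] [InnerProductSpace ℝ H] [CompleteSpace H]
    {V : H × α → ℝ} {Vx : H × α → (H →L[ℝ] ℝ)} {x₀ : H} {U : Set H} (hU : U ∈ 𝓝 x₀)
    (hVm : ∀ x ∈ U, AEStronglyMeasurable (fun y => V (x, y)) μ)
    (hI : Integrable (fun y => exp (-V (x₀, y))) μ)
    (hVxm : AEStronglyMeasurable (fun y => Vx (x₀, y)) μ)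
    (hVd : ∀ x ∈ U, ∀ y, HasFDerivAt (fun x' => V (x', y)) (Vx (x, y)) x)
    {bound : α → ℝ} (hbound : Integrable bound μ) (hb : ∀ x ∈ U, ∀ y, exp (-V (x, y)) * ‖Vx (x, y)‖ ≤ bound y)
    (hZ : 0 < ∫ y, exp (-V (x₀, y)) ∂μ) :
    HasGradientAt (fun x => -log (∫ y, exp (-V (x, y)) ∂μ))
      ((InnerProductSpace.toDual ℝ H).symm
        ((∫ y, exp (-V (x₀, y)) ∂μ)⁻¹ • ∫ y, exp (-V (x₀, y)) • Vx (x₀, y) ∂μ)) x₀ := by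
  rw [hasGradientAt_iff_hasFDerivAt, LinearIsometryEquiv.apply_symm_apply]
  exact hasFDerivAt_neg_log_fibreIntegral hU hVm hI hVxm hVd hbound hb hZ

end FibreIntegral

/-! ## §3 The bounded-window supplier: a finite fibre measure and two constants discharge the domination letters -/

section Bounded

variable {H : Type*} [NormedAddCommGroup H] [NormedSpace ℝ H] {α : Type*} [MeasurableSpace α] {μ : Measure α}

/-- **BOUNDED-WINDOW SUPPLIER**: `μ` finite (a bounded fluctuation window), `V ≥ vmin` and `‖Vx‖ ≤ M` on `U × α`, measurable sections and
`Vx(x₀,·)` a.e.-strongly measurable, `HasFDerivAt` in the base variable on `U`, and `0 < ∫ e^{−V(x₀,·)} dμ` ⟹ the marginal exponent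
`−log ∫ e^{−V(·,y)} dμ` has derivative `Z⁻¹ • ∫ e^{−V(x₀,y)} • Vx(x₀,y) dμ` at `x₀`. [folklore] -/
theorem hasFDerivAt_neg_log_fibreIntegral_of_bounded [IsFiniteMeasure μ] {V : H × α → ℝ} {Vx : H × α → (H →L[ℝ] ℝ)} {x₀ : H}
    {U : Set H} (hU : U ∈ 𝓝 x₀) (hVm : ∀ x ∈ U, AEStronglyMeasurable (fun y => V (x, y)) μ)
    (hVxm : AEStronglyMeasurable (fun y => Vx (x₀, y)) μ)
    (hVd : ∀ x ∈ U, ∀ y, HasFDerivAt (fun x' => V (x', y)) (Vx (x, y)) x)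
    {vmin M : ℝ} (hVlow : ∀ x ∈ U, ∀ y, vmin ≤ V (x, y)) (hM : ∀ x ∈ U, ∀ y, ‖Vx (x, y)‖ ≤ M)
    (hZ : 0 < ∫ y, exp (-V (x₀, y)) ∂μ) :
    HasFDerivAt (fun x => -log (∫ y, exp (-V (x, y)) ∂μ))
      ((∫ y, exp (-V (x₀, y)) ∂μ)⁻¹ • ∫ y, exp (-V (x₀, y)) • Vx (x₀, y) ∂μ) x₀ := by
  have hx₀ : x₀ ∈ U := mem_of_mem_nhds hU
  have hexp : ∀ x ∈ U, ∀ y, exp (-V (x, y)) ≤ exp (-vmin) := fun x hx y => exp_le_exp.2 (neg_le_neg (hVlow x hx y))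
  have hI : Integrable (fun y => exp (-V (x₀, y))) μ :=
    Integrable.mono' (integrable_const (exp (-vmin)))
      (continuous_exp.comp_aestronglyMeasurable (hVm x₀ hx₀).neg)
      (Eventually.of_forall fun y => by
        rw [Real.norm_eq_abs, abs_of_pos (exp_pos _)]
        exact hexp x₀ hx₀ y)
  refine hasFDerivAt_neg_log_fibreIntegral hU hVm hI hVxm hVd (integrable_const (exp (-vmin) * M))
    (fun x hx y => ?_) hZ
  exact mul_le_mul (hexp x hx y) (hM x hx y) (norm_nonneg _) (exp_pos _).le

end Bounded

/-! ## §4 Junction with `…LogConcaveMarginal`'s fibres for a PRODUCT window -/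

section Product

variable {X Y : Type*}

/-- For a product window `K = B ×ˢ K_y` and a base point `x ∈ B`, the fibre `{y : (x, y) ∈ K}` is `K_y`. [folklore] -/
theorem fibre_prod_eq {B : Set X} {Ky : Set Y} {x : X} (hx : x ∈ B) : Prod.mk x ⁻¹' (B ×ˢ Ky) = Ky := by
  ext y
  simp [hx]

/-- Near an INTERIOR base point of `B` the windowed fibre integral of `…LogConcaveMarginal` (fibre `{y : (x,y) ∈ B ×ˢ K_y}`) coincides with
the fixed-fibre integral over `K_y`; hence `HasFDerivAt` ∕ `HasGradientAt` statements transfer between the two by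
`HasFDerivAt.congr_of_eventuallyEq`. [folklore] -/
theorem eventuallyEq_fibreIntegral_prod [TopologicalSpace X] [MeasurableSpace Y] {μ : Measure Y} {B : Set X} {Ky : Set Y}
    {x₀ : X} (hB : B ∈ 𝓝 x₀) (f : X → Y → ℝ) :
    (fun x => ∫ y in Prod.mk x ⁻¹' (B ×ˢ Ky), f x y ∂μ) =ᶠ[𝓝 x₀] fun x => ∫ y in Ky, f x y ∂μ := by
  filter_upwards [hB] with x hx
  rw [fibre_prod_eq hx]

/-- The transfer spelled out for the marginal exponent: if `x ↦ −log ∫_{K_y} e^{−V(x,·)} dμ` has derivative `D` at an interior point `x₀`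
of `B`, so does `x ↦ −log ∫_{{y : (x,y) ∈ B ×ˢ K_y}} e^{−V(x,·)} dμ`. [folklore] -/
theorem hasFDerivAt_neg_log_windowedFibreIntegral_prod {H : Type*} [NormedAddCommGroup H] [NormedSpace ℝ H] {Y : Type*}
    [MeasurableSpace Y] {μ : Measure Y} {B : Set H} {Ky : Set Y} {x₀ : H} (hB : B ∈ 𝓝 x₀) {V : H × Y → ℝ} {D : H →L[ℝ] ℝ}
    (h : HasFDerivAt (fun x => -log (∫ y in Ky, exp (-V (x, y)) ∂μ)) D x₀) :
    HasFDerivAt (fun x => -log (∫ y in Prod.mk x ⁻¹' (B ×ˢ Ky), exp (-V (x, y)) ∂μ)) D x₀ := by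
  refine h.congr_of_eventuallyEq ?_
  filter_upwards [hB] with x hx
  rw [fibre_prod_eq hx]

end Product

end Summit.QuantumFields.BalabanUV.T4Continuum.NE7b.LogConcaveMarginalDeriv
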